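import Mathlib
import Summits.ValiantsHypothesis.ValiantsHypothesis.Theorems.DivisionGapPerMultiplesHardStubTypedDecompositionFifth
import Summits.ValiantsHypothesis.ValiantsHypothesis.Theorems.DivisionGapPerMultiplesHardStubZRigidity
import Literature.Computability.AlgebraicComplexity.ArithCircuitProofs
import Literature.Computability.AlgebraicComplexity.PermanentIrreducible

/-!
# The k-cell spread engine (line `uncharged-face-walk` of crux `PerMultiplesHard`, route DivisionGap)

Stubs `zSpreadPatterns` + `zSpreadPatternsCol` of the line, now theorems.  Fix a set `Z` of `k`
permutations of `Fin n` (the probe shifts), `1 ≤ k`, `3k ≤ n`, and a TORUS-HOMOGENEOUS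
`g ∈ ℝ≥0[x_ij]` (`n × n` variables; all monomials have the same row margins `R` and column margins
`C`) all of whose rows are hit (`R i ≠ 0`).  Call an exponent `M` a `Z`-PROBE for a permutation
`π` if every cell `(a, b)` of `M` has `π b = ζ a` for some `ζ ∈ Z` (row `a` uses only the `k`
columns `π⁻¹ (ζ a)`).  Then the number of permutations `π` admitting a `Z`-probe in `supp g`
satisfies `# · 3^{⌊n/(3k²)⌋} ≤ L(g) · 2^{⌊n/(3k²)⌋} · n!` (`zSpreadPatterns`; `L = complexity`), and
likewise for the transposed (column) probes when all columns are hit (`zSpreadPatternsCol`, via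
`rename Prod.swap`).

Mechanism: the typed decomposition with the parametric window `D = 3k`
(`…TypedDecompositionFifth.typedDecompositionWindow`, p105314): `g = Σ_{t<s} a_t b_t`, `s ≤ L(g)`,
every `a_t` torus-homogeneous with row support `#S` in the window `n < 3k·#S ≤ 2n`; a `Z`-probe
in `supp (a_t b_t)` forces `π` to be `Z`-COMPATIBLE with the type `(S, T)` of `a_t`
(`zCompatible_of_probe`); and `Z`-rigidity (`…ZRigidity.stub_zRigidity`, p105440) bounds the
compatible permutations by `#compat · 3^{⌊n/(3k²)⌋} ≤ 2^{⌊n/(3k²)⌋} · n!`.  Sum over `t`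
(`zCount_le_of_decomposition`).

-- adapted from Cruxes/PerMultiplesHard/Lines/uncharged_face_walk.lean (section "The k-cell spread
-- engine", sorry-free there; the skeleton-local definitions `IsZProbe`, `zCount`, `colZCount`,
-- `zCompatible` are inlined here)
-/

noncomputable section

-- the namespace is mandated by the crux (`Summit.ValiantsHypothesis.ValiantsHypothesis.…`)
set_option linter.dupNamespace false

namespace Summit.ValiantsHypothesis.ValiantsHypothesis.Theorems.DivisionGap.PerMultiplesHard.ZSpreadPatterns

open MvPolynomial Literature.Computability.AlgebraicComplexity
open scoped NNReal BigOperators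

/-- **`Z`-probes force `Z`-compatibility.**  If a monomial `m` of `a · b` is a `Z`-probe for `π`
and `a` is torus-homogeneous with margins `(ρ, γ)`, then `π` is `Z`-compatible with the type
`(S, T) = ({i | ρ i ≠ 0}, {j | γ j ≠ 0})`: every `i ∈ S` has `π⁻¹ (ζ i) ∈ T` for some `ζ ∈ Z`, and
every `j ∈ T` has `π j = ζ i` for some `ζ ∈ Z`, `i ∈ S` (the part `B ∈ supp a` of `m = B + B'`
is a `Z`-probe too, and its nonzero cells witness both clauses). [folklore] -/
theorem zCompatible_of_probe {n : ℕ} {Z : Finset (Equiv.Perm (Fin n))}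
    {a b : MvPolynomial (Fin n × Fin n) ℝ≥0}
    {m : (Fin n × Fin n) →₀ ℕ} (hm : m ∈ (a * b).support) (π : Equiv.Perm (Fin n))
    (hπ : ∀ e ∈ m.support, ∃ ζ ∈ Z, π e.2 = ζ e.1) {ρ γ : Fin n → ℕ}
    (hty : ∀ B ∈ a.support, (∀ i, ∑ j, B (i, j) = ρ i) ∧ (∀ j, ∑ i, B (i, j) = γ j)) :
    π ∈ (Finset.univ : Finset (Equiv.Perm (Fin n))).filter fun π =>
      (∀ i ∈ (Finset.univ.filter fun i => ρ i ≠ 0), ∃ ζ ∈ Z,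
          π.symm (ζ i) ∈ (Finset.univ.filter fun j => γ j ≠ 0)) ∧
        (∀ j ∈ (Finset.univ.filter fun j => γ j ≠ 0), ∃ ζ ∈ Z,
          ∃ i ∈ (Finset.univ.filter fun i => ρ i ≠ 0), ζ i = π j) := by
  classical
  obtain ⟨B, hB, B', -, hBB'⟩ := Finset.mem_add.mp (MvPolynomial.support_mul a b hm)
  have hle : ∀ e, B e ≤ m e := fun e => by rw [← hBB', Finsupp.add_apply]; exact Nat.le_add_right _ _
  obtain ⟨hρ, hγ⟩ := hty B hB
  have hcell : ∀ e, B e ≠ 0 → ∃ ζ ∈ Z, π e.2 = ζ e.1 := fun e he =>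
    hπ e (Finsupp.mem_support_iff.mpr (fun h0 => he (Nat.eq_zero_of_le_zero (h0 ▸ hle e))))
  have hρ_of : ∀ i j, B (i, j) ≠ 0 → ρ i ≠ 0 := by
    intro i j hij h0
    have h1 : B (i, j) ≤ ∑ j', B (i, j') :=
      Finset.single_le_sum (f := fun j' => B (i, j')) (fun _ _ => Nat.zero_le _) (Finset.mem_univ j)
    rw [hρ i, h0] at h1
    exact hij (Nat.eq_zero_of_le_zero h1)
  have hγ_of : ∀ i j, B (i, j) ≠ 0 → γ j ≠ 0 := by
    intro i j hij h0
    have h1 : B (i, j) ≤ ∑ i', B (i', j) :=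
      Finset.single_le_sum (f := fun i' => B (i', j)) (fun _ _ => Nat.zero_le _) (Finset.mem_univ i)
    rw [hγ j, h0] at h1
    exact hij (Nat.eq_zero_of_le_zero h1)
  refine Finset.mem_filter.mpr ⟨Finset.mem_univ _, ?_, ?_⟩
  · intro i hi
    have hρi : ρ i ≠ 0 := (Finset.mem_filter.mp hi).2
    have hex : ∃ j, B (i, j) ≠ 0 := by
      by_contra hcon
      push Not at hcon
      exact hρi ((hρ i).symm.trans (Finset.sum_eq_zero fun j _ => hcon j))
    obtain ⟨j, hj⟩ := hex
    have hjT : j ∈ Finset.univ.filter (fun j => γ j ≠ 0) :=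
      Finset.mem_filter.mpr ⟨Finset.mem_univ _, hγ_of i j hj⟩
    obtain ⟨ζ, hζ, hz⟩ := hcell (i, j) hj
    have hz' : π j = ζ i := hz
    refine ⟨ζ, hζ, ?_⟩
    have : π.symm (ζ i) = j := by rw [← hz']; exact π.symm_apply_apply j
    rw [this]; exact hjT
  · intro j hj
    have hγj : γ j ≠ 0 := (Finset.mem_filter.mp hj).2
    have hex : ∃ i, B (i, j) ≠ 0 := by
      by_contra hcon
      push Not at hcon
      exact hγj ((hγ j).symm.trans (Finset.sum_eq_zero fun i _ => hcon i))
    obtain ⟨i, hi⟩ := hex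
    have hiS : i ∈ Finset.univ.filter (fun i => ρ i ≠ 0) :=
      Finset.mem_filter.mpr ⟨Finset.mem_univ _, hρ_of i j hi⟩
    obtain ⟨ζ, hζ, hz⟩ := hcell (i, j) hi
    exact ⟨ζ, hζ, i, hiS, (show π j = ζ i from hz).symm⟩

/-- **Counting lemma for `Z`-probes.**  If `g = Σ_{t<s} a_t b_t` and, for every `t`, the number of
permutations admitting a `Z`-probe in `supp (a_t b_t)` is at most `K / 3^f`, then the number of
permutations admitting a `Z`-probe in `supp g` is at most `s K / 3^f`
(`supp g ⊆ ⋃_t supp (a_t b_t)`). [folklore] -/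
theorem zCount_le_of_decomposition {n s : ℕ} (Z : Finset (Equiv.Perm (Fin n))) (f : ℕ)
    (g : MvPolynomial (Fin n × Fin n) ℝ≥0)
    (a b : Fin s → MvPolynomial (Fin n × Fin n) ℝ≥0) (hg : g = ∑ t, a t * b t) (K : ℕ)
    (hK : ∀ t, ((Finset.univ : Finset (Equiv.Perm (Fin n))).filter fun π =>
        ∃ m ∈ (a t * b t).support, ∀ e ∈ m.support, ∃ ζ ∈ Z, π e.2 = ζ e.1).card * 3 ^ f ≤ K) :
    ((Finset.univ : Finset (Equiv.Perm (Fin n))).filter fun π =>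
        ∃ m ∈ g.support, ∀ e ∈ m.support, ∃ ζ ∈ Z, π e.2 = ζ e.1).card * 3 ^ f ≤ s * K := by
  classical
  have h1 : ((Finset.univ : Finset (Equiv.Perm (Fin n))).filter fun π =>
        ∃ m ∈ g.support, ∀ e ∈ m.support, ∃ ζ ∈ Z, π e.2 = ζ e.1) ⊆
      Finset.univ.biUnion fun t => (Finset.univ : Finset (Equiv.Perm (Fin n))).filter fun π =>
        ∃ m ∈ (a t * b t).support, ∀ e ∈ m.support, ∃ ζ ∈ Z, π e.2 = ζ e.1 := by
    intro π hπ
    obtain ⟨-, m, hmg, hprobe⟩ := Finset.mem_filter.mp hπ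
    rw [hg] at hmg
    obtain ⟨t, -, ht⟩ := Finset.mem_biUnion.mp (MvPolynomial.support_sum hmg)
    exact Finset.mem_biUnion.mpr ⟨t, Finset.mem_univ t,
      Finset.mem_filter.mpr ⟨Finset.mem_univ _, m, ht, hprobe⟩⟩
  calc ((Finset.univ : Finset (Equiv.Perm (Fin n))).filter fun π =>
          ∃ m ∈ g.support, ∀ e ∈ m.support, ∃ ζ ∈ Z, π e.2 = ζ e.1).card * 3 ^ f
      ≤ (Finset.univ.biUnion fun t => (Finset.univ : Finset (Equiv.Perm (Fin n))).filter fun π =>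
          ∃ m ∈ (a t * b t).support, ∀ e ∈ m.support, ∃ ζ ∈ Z, π e.2 = ζ e.1).card * 3 ^ f :=
        Nat.mul_le_mul_right _ (Finset.card_le_card h1)
    _ ≤ (∑ t, ((Finset.univ : Finset (Equiv.Perm (Fin n))).filter fun π =>
          ∃ m ∈ (a t * b t).support, ∀ e ∈ m.support, ∃ ζ ∈ Z, π e.2 = ζ e.1).card) * 3 ^ f :=
        Nat.mul_le_mul_right _ Finset.card_biUnion_le
    _ = ∑ t, ((Finset.univ : Finset (Equiv.Perm (Fin n))).filter fun π =>
          ∃ m ∈ (a t * b t).support, ∀ e ∈ m.support, ∃ ζ ∈ Z, π e.2 = ζ e.1).card * 3 ^ f :=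
        Finset.sum_mul _ _ _
    _ ≤ ∑ _t : Fin s, K := Finset.sum_le_sum fun t _ => hK t
    _ = s * K := by rw [Finset.sum_const, Finset.card_univ, Fintype.card_fin, smul_eq_mul]

/-- **The k-cell spread engine (`zSpreadPatterns`).**  For `1 ≤ k = #Z`, `3k ≤ n` and a
torus-homogeneous `g` with all rows hit, the number of permutations `π` admitting a `Z`-probe in
`supp g` (a monomial all of whose cells `(a, b)` have `π b = ζ a` for some `ζ ∈ Z`) satisfies
`# · 3^{⌊n/(3k²)⌋} ≤ L(g) · 2^{⌊n/(3k²)⌋} · n!` — every permutation near which `g` has a monomial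
using at most the `k` probe cells per row costs `(3/2)^{n/(3k²)}/n!` of a gate.  Composition of
`typedDecompositionWindow` (window `D = 3k`) and `stub_zRigidity` through
`zCompatible_of_probe` and `zCount_le_of_decomposition`. [folklore] -/
theorem zSpreadPatterns :
    ∀ (n k : ℕ) (Z : Finset (Equiv.Perm (Fin n))), Z.card = k → 1 ≤ k → 3 * k ≤ n →
      ∀ (g : MvPolynomial (Fin n × Fin n) ℝ≥0) (R C : Fin n → ℕ),
        (∀ m ∈ g.support, (∀ i, ∑ j, m (i, j) = R i) ∧ (∀ j, ∑ i, m (i, j) = C j)) → (∀ i, R i ≠ 0) →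
        ((Finset.univ : Finset (Equiv.Perm (Fin n))).filter fun π =>
            ∃ m ∈ g.support, ∀ e ∈ m.support, ∃ ζ ∈ Z, π e.2 = ζ e.1).card * 3 ^ (n / (3 * k ^ 2)) ≤
          complexity g * (2 ^ (n / (3 * k ^ 2)) * n.factorial) := by
  classical
  intro n k Z hZ hk hkn g R C hg hR
  obtain ⟨s, hs, a, b, hgab, htyp⟩ :=
    Summit.ValiantsHypothesis.ValiantsHypothesis.Theorems.DivisionGap.PerMultiplesHard.TypedDecompositionFifth.typedDecompositionWindow
      n (3 * k) (by omega) hkn g R C hg hR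
  have hK : ∀ t, ((Finset.univ : Finset (Equiv.Perm (Fin n))).filter fun π =>
      ∃ m ∈ (a t * b t).support, ∀ e ∈ m.support, ∃ ζ ∈ Z, π e.2 = ζ e.1).card * 3 ^ (n / (3 * k ^ 2)) ≤
        2 ^ (n / (3 * k ^ 2)) * n.factorial := by
    intro t
    obtain ⟨ρ, γ, hty, hlo, hhi⟩ := htyp t
    set S : Finset (Fin n) := Finset.univ.filter fun i => ρ i ≠ 0
    set T : Finset (Fin n) := Finset.univ.filter fun j => γ j ≠ 0
    have hsub : ((Finset.univ : Finset (Equiv.Perm (Fin n))).filter fun π =>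
        ∃ m ∈ (a t * b t).support, ∀ e ∈ m.support, ∃ ζ ∈ Z, π e.2 = ζ e.1) ⊆
        (Finset.univ : Finset (Equiv.Perm (Fin n))).filter fun π =>
          (∀ i ∈ S, ∃ ζ ∈ Z, π.symm (ζ i) ∈ T) ∧ (∀ j ∈ T, ∃ ζ ∈ Z, ∃ i ∈ S, ζ i = π j) := by
      intro π hπ
      obtain ⟨-, m, hm, hprobe⟩ := Finset.mem_filter.mp hπ
      exact zCompatible_of_probe hm π hprobe hty
    have hrig :=
      Summit.ValiantsHypothesis.ValiantsHypothesis.Theorems.DivisionGap.PerMultiplesHard.ZRigidity.stub_zRigidity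
        n k S.card Z S T hZ rfl hlo hhi
    calc ((Finset.univ : Finset (Equiv.Perm (Fin n))).filter fun π =>
            ∃ m ∈ (a t * b t).support, ∀ e ∈ m.support, ∃ ζ ∈ Z, π e.2 = ζ e.1).card *
            3 ^ (n / (3 * k ^ 2))
        ≤ ((Finset.univ : Finset (Equiv.Perm (Fin n))).filter fun π =>
            (∀ i ∈ S, ∃ ζ ∈ Z, π.symm (ζ i) ∈ T) ∧ (∀ j ∈ T, ∃ ζ ∈ Z, ∃ i ∈ S, ζ i = π j)).card *
            3 ^ (n / (3 * k ^ 2)) :=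
          Nat.mul_le_mul_right _ (Finset.card_le_card hsub)
      _ ≤ 2 ^ (n / (3 * k ^ 2)) * n.factorial := hrig
  calc ((Finset.univ : Finset (Equiv.Perm (Fin n))).filter fun π =>
          ∃ m ∈ g.support, ∀ e ∈ m.support, ∃ ζ ∈ Z, π e.2 = ζ e.1).card * 3 ^ (n / (3 * k ^ 2))
      ≤ s * (2 ^ (n / (3 * k ^ 2)) * n.factorial) :=
        zCount_le_of_decomposition Z _ g a b hgab _ hK
    _ ≤ complexity g * (2 ^ (n / (3 * k ^ 2)) * n.factorial) := Nat.mul_le_mul_right _ hs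

/-- **The transposed k-cell engine (`zSpreadPatternsCol`).**  For `1 ≤ k = #Z`, `3k ≤ n` and a
torus-homogeneous `g` with all COLUMNS hit, the number of permutations `π` admitting a column
`Z`-probe in `supp g` (every cell `(a, b)` has `π a = ζ b` for some `ζ ∈ Z`) satisfies
`# · 3^{⌊n/(3k²)⌋} ≤ L(g) · 2^{⌊n/(3k²)⌋} · n!`.  Via `rename Prod.swap` (complexity-preserving,
`complexity_rename_of_injective_holds`) from `zSpreadPatterns`. [folklore] -/
theorem zSpreadPatternsCol :
    ∀ (n k : ℕ) (Z : Finset (Equiv.Perm (Fin n))), Z.card = k → 1 ≤ k → 3 * k ≤ n →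
      ∀ (g : MvPolynomial (Fin n × Fin n) ℝ≥0) (R C : Fin n → ℕ),
        (∀ m ∈ g.support, (∀ i, ∑ j, m (i, j) = R i) ∧ (∀ j, ∑ i, m (i, j) = C j)) → (∀ j, C j ≠ 0) →
        ((Finset.univ : Finset (Equiv.Perm (Fin n))).filter fun π =>
            ∃ m ∈ g.support, ∀ e ∈ m.support, ∃ ζ ∈ Z, π e.1 = ζ e.2).card * 3 ^ (n / (3 * k ^ 2)) ≤
          complexity g * (2 ^ (n / (3 * k ^ 2)) * n.factorial) := by
  classical
  intro n k Z hZ hk hkn g R C hg hC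
  have hsw : Function.Injective (Prod.swap : Fin n × Fin n → Fin n × Fin n) := Prod.swap_injective
  set gT : MvPolynomial (Fin n × Fin n) ℝ≥0 := rename Prod.swap g
  have hsupp : gT.support = g.support.image (Finsupp.mapDomain Prod.swap) :=
    MvPolynomial.support_rename_of_injective hsw
  have happ : ∀ (m : (Fin n × Fin n) →₀ ℕ) (a b : Fin n),
      Finsupp.mapDomain Prod.swap m (a, b) = m (b, a) := by
    intro m a b
    have : ((a, b) : Fin n × Fin n) = Prod.swap (b, a) := rfl
    rw [this, Finsupp.mapDomain_apply hsw]
  have hgT' : ∀ m ∈ gT.support, (∀ i, ∑ j, m (i, j) = C i) ∧ (∀ j, ∑ i, m (i, j) = R j) := by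
    intro m' hm'
    rw [hsupp, Finset.mem_image] at hm'
    obtain ⟨m, hm, rfl⟩ := hm'
    obtain ⟨hr, hc⟩ := hg m hm
    refine ⟨fun i => ?_, fun j => ?_⟩
    · rw [← hc i]; exact Finset.sum_congr rfl fun j _ => happ m i j
    · rw [← hr j]; exact Finset.sum_congr rfl fun i _ => happ m i j
  have heng := zSpreadPatterns n k Z hZ hk hkn gT C R hgT' hC
  have hcx : complexity gT = complexity g := complexity_rename_of_injective_holds hsw g
  have hle : ((Finset.univ : Finset (Equiv.Perm (Fin n))).filter fun π =>
        ∃ m ∈ g.support, ∀ e ∈ m.support, ∃ ζ ∈ Z, π e.1 = ζ e.2) ⊆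
      (Finset.univ : Finset (Equiv.Perm (Fin n))).filter fun π =>
        ∃ m ∈ gT.support, ∀ e ∈ m.support, ∃ ζ ∈ Z, π e.2 = ζ e.1 := by
    intro π hπ
    obtain ⟨-, M, hM, hprobe⟩ := Finset.mem_filter.mp hπ
    refine Finset.mem_filter.mpr ⟨Finset.mem_univ _, Finsupp.mapDomain Prod.swap M, ?_, ?_⟩
    · rw [hsupp]; exact Finset.mem_image_of_mem _ hM
    · intro e he
      rw [Finsupp.mapDomain_support_of_injective hsw, Finset.mem_image] at he
      obtain ⟨e₀, he₀, rfl⟩ := he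
      simpa [Prod.fst_swap, Prod.snd_swap] using hprobe e₀ he₀
  calc ((Finset.univ : Finset (Equiv.Perm (Fin n))).filter fun π =>
          ∃ m ∈ g.support, ∀ e ∈ m.support, ∃ ζ ∈ Z, π e.1 = ζ e.2).card * 3 ^ (n / (3 * k ^ 2))
      ≤ ((Finset.univ : Finset (Equiv.Perm (Fin n))).filter fun π =>
          ∃ m ∈ gT.support, ∀ e ∈ m.support, ∃ ζ ∈ Z, π e.2 = ζ e.1).card * 3 ^ (n / (3 * k ^ 2)) :=
        Nat.mul_le_mul_right _ (Finset.card_le_card hle)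
    _ ≤ complexity gT * (2 ^ (n / (3 * k ^ 2)) * n.factorial) := heng
    _ = complexity g * (2 ^ (n / (3 * k ^ 2)) * n.factorial) := by rw [hcx]

end Summit.ValiantsHypothesis.ValiantsHypothesis.Theorems.DivisionGap.PerMultiplesHard.ZSpreadPatterns
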